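import Mathlib
import Literature.Barriers.PneNP.CutPolytopeXCLowerBound
import Literature.Barriers.PneNP.TSPExtensionComplexityHyperplaneBound
import Literature.Barriers.PneNP.TSPExtensionComplexityKaibelWeltge
import HarnessLib

/-!
# Braun–Fiorini–Pokutta–Steurer 2012, Proposition 3: Max CUT with arbitrary weights has no
# `ρ`-approximate extended formulation of sub-exponential size, for ANY `ρ ≥ 1` — PROVED

G. Braun, S. Fiorini, S. Pokutta, D. Steurer, *Approximation Limits of Linear Programs (Beyond Hierarchies)*,
FOCS 2012 = arXiv:1204.0957 [BraunEtAl2012] (journal: Math. Oper. Res. 40 (2015) [BraunEtAl2015]), §2.3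
(p. 8, materialised `paper:arxiv-1204.0957` p0008): «**Proposition 3.** For every `ρ ≥ 1`, every
`ρ`-approximate EF of the Max CUT problem with arbitrary weights has size `2^{Ω(n)}`. More precisely,
disregarding the value of `ρ ≥ 1`, we have `xc(CUT(n), ρ CUT(n)) = 2^{Ω(n)}`.»

The printed proof, followed here: an EF `Ex + Fy = g, y ≥ 0` of size `r` of a polyhedron `K` with
`CUT(n) ⊆ K ⊆ ρ CUT(n)` yields the HOMOGENISED system `Ex + Fy − λg = 0, y ≥ 0, λ ≥ 0` of size `r + 1`
(`ExtendedFormulation.homogenize`); its projection `K'` contains the cut vectors, and every HOMOGENEOUS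
inequality valid on `K` stays valid on `K'` («If `λ = 0` then necessarily `x = 0` because `Ex + Fy = 0,
y ≥ 0` defines the recession cone of a polyhedron that projects into `ρCUT(n)`, which is bounded … Assume
that `λ > 0`. Then … `λ^{−1}x` is in `ρ CUT(n)`», `ExtendedFormulation.nonneg_on_homogenize`).  Passing to
correlation coordinates by the covariance map (tree: `DeSimoneXC.covMap`, [DeSimone90]) the inequalities
`⟨T_a, z⟩ ≥ 0`, `T_a = (−1,a)(−1,a)ᵀ`, are valid (psd against psd) and the points `U^b = (1,b)(1,b)ᵀ` are
vertices, with slack `⟨T_a, U^b⟩ = (1 − aᵀb)²` — the unique-disjointness matrix on `[n−2]` (p. 8,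
(2.7)).  Yannakakis' factorisation (tree: `HasEFOfSize.exists_nonneg_factorization`) then gives a
nonnegative factorisation of UDISJ through `r + 2` slots, and the tree's Kaibel–Weltge rectangle bound
(`three_pow_le_card_mul_two_pow_of_cover_univ`; the print invokes [Razborov92] / [FMPTW] for `2^{Ω(n)}`)
gives `(3/2)^{n−2} ≤ r + 2`.

* `corPolytope_sandwich_xc_ge` — COR form: `COR(m+1) ⊆ K ⊆ ρ·COR(m+1)`, `HasEFOfSize K r` ⇒ `(3/2)^m ≤ r + 2`.
* `BFPS2012_prop3` — ★ **Proposition 3** as printed, for `CUT(n+2) = CUT□(K_{n+2})`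
  (`Literature.Combinatorics.Optimization.cutPolytope ⊤`): `CUT(n+2) ⊆ K ⊆ ρ·CUT(n+2)`, `ρ ≥ 1`,
  `HasEFOfSize K r` ⇒ `(3/2)^n ≤ r + 2`.

0 named facts; everything PROVED.  Nothing here is a summit statement; no P-vs-NP content.
-/

noncomputable section

namespace Literature.Barriers.PneNP

open Matrix Finset
open scoped Pointwise
open Literature.Combinatorics.Optimization (cutPolytope)
open Literature.Combinatorics.Optimization.FixedSizePsdRank (Cube bvec vecOuter flat corPolytope
  flat_dotProduct_vecOuter isBounded_corPolytope)

/-! ### Homogenising an extended formulation -/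

section Homogenize

variable {ι : Type} [Fintype ι] {r : ℕ}

/-- The homogenised system `Ex + Fy − λ g = 0`, `y ≥ 0`, `λ ≥ 0` (one more sign-constrained variable).
[cite: BraunEtAl2012, §2.3 proof of Prop. 3, eq. (2.6) (p. 8)] -/
def ExtendedFormulation.homogenize (Q : ExtendedFormulation ι r) : ExtendedFormulation ι (r + 1) where
  k := Q.k
  E := Q.E
  F := Matrix.of fun i j => Fin.lastCases (-Q.g i) (fun j' => Q.F i j') j
  g := 0

/-- The homogenised system, unfolded: `E x + F' y' = 0` iff `E x + F y = λ g` with `y = y'|_{[r]}`,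
`λ = y'_{r+1}`. [cite: BraunEtAl2012, §2.3 proof of Prop. 3, eq. (2.6) (p. 8)] -/
theorem ExtendedFormulation.homogenize_apply (Q : ExtendedFormulation ι r) (x : ι → ℝ) (y' : Fin (r + 1) → ℝ) :
    Q.homogenize.E *ᵥ x + Q.homogenize.F *ᵥ y' = Q.homogenize.g ↔
      Q.E *ᵥ x + Q.F *ᵥ (fun j => y' (Fin.castSucc j)) = y' (Fin.last r) • Q.g := by
  have h : ∀ i, (Q.homogenize.F *ᵥ y') i =
      (Q.F *ᵥ fun j => y' (Fin.castSucc j)) i - y' (Fin.last r) * Q.g i := by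
    intro i
    simp only [ExtendedFormulation.homogenize, mulVec, dotProduct, Matrix.of_apply]
    rw [Fin.sum_univ_castSucc]
    simp only [Fin.lastCases_castSucc, Fin.lastCases_last]
    ring
  constructor
  · intro H
    funext i
    have Hi := congrFun H i
    change (Q.E *ᵥ x) i + (Q.homogenize.F *ᵥ y') i = 0 at Hi
    rw [h i] at Hi
    simp only [Pi.add_apply, Pi.smul_apply, smul_eq_mul]
    linarith
  · intro H
    funext i
    have Hi := congrFun H i
    simp only [Pi.add_apply, Pi.smul_apply, smul_eq_mul] at Hi
    change (Q.E *ᵥ x) i + (Q.homogenize.F *ᵥ y') i = 0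
    rw [h i]
    linarith

/-- `K ⊆ K'` (take `λ = 1`). [cite: BraunEtAl2012, §2.3 proof of Prop. 3 ("`K` is a cone containing all
the cut-vectors", p. 8)] -/
theorem ExtendedFormulation.mem_homogenize_of_mem (Q : ExtendedFormulation ι r) {x : ι → ℝ}
    (hx : x ∈ Q.projSet) : x ∈ Q.homogenize.projSet := by
  obtain ⟨y, hy, hxy⟩ := hx
  refine ⟨Fin.snoc y 1, fun j => ?_, ?_⟩
  · refine Fin.lastCases ?_ (fun j' => ?_) j
    · rw [Fin.snoc_last]; norm_num
    · rw [Fin.snoc_castSucc]; exact hy j'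
  · rw [Q.homogenize_apply]
    simp only [Fin.snoc_castSucc, Fin.snoc_last, one_smul]
    exact hxy

/-- Unpacking `x ∈ K'`: `Ex + Fy = λ g` with `y ≥ 0`, `λ ≥ 0`. [cite: BraunEtAl2012, §2.3 proof of
Prop. 3 (p. 8)] -/
theorem ExtendedFormulation.exists_of_mem_homogenize (Q : ExtendedFormulation ι r) {x : ι → ℝ}
    (hx : x ∈ Q.homogenize.projSet) :
    ∃ (y : Fin r → ℝ) (t : ℝ), (∀ j, 0 ≤ y j) ∧ 0 ≤ t ∧ Q.E *ᵥ x + Q.F *ᵥ y = t • Q.g := by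
  obtain ⟨y', hy', hxy⟩ := hx
  exact ⟨fun j => y' (Fin.castSucc j), y' (Fin.last r), fun j => hy' _, hy' _, (Q.homogenize_apply x y').1 hxy⟩

/-- **The homogenisation step**: a homogeneous linear inequality `c·x ≥ 0` valid on the BOUNDED,
non-empty projection `K` stays valid on the projection `K'` of the homogenised system («If `λ = 0` then
necessarily `x = 0` because `Ex + Fy = 0, y ≥ 0` defines the recession cone of a polyhedron that projects
into `ρ CUT(n)`, which is bounded. … Assume that `λ > 0`. Then … `λ^{−1} x` is in `ρ CUT(n)`», p. 8).
[cite: BraunEtAl2012, §2.3 proof of Prop. 3 (p. 8)] -/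
theorem ExtendedFormulation.nonneg_on_homogenize (Q : ExtendedFormulation ι r)
    (hbdd : Bornology.IsBounded Q.projSet) (hne : Q.projSet.Nonempty) {c : ι → ℝ}
    (hc : ∀ x ∈ Q.projSet, 0 ≤ c ⬝ᵥ x) : ∀ x ∈ Q.homogenize.projSet, 0 ≤ c ⬝ᵥ x := by
  intro x hx
  obtain ⟨y, t, hy, ht, hxy⟩ := Q.exists_of_mem_homogenize hx
  rcases ht.eq_or_lt with ht0 | htpos
  · -- `λ = 0`: `x` is a recession direction of the lift, hence `x = 0` by boundedness
    subst ht0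
    rw [zero_smul] at hxy
    obtain ⟨x₀, hx₀⟩ := hne
    obtain ⟨y₀, hy₀, hx₀y₀⟩ := hx₀
    have hray : ∀ s : ℝ, 0 ≤ s → x₀ + s • x ∈ Q.projSet := by
      intro s hs
      refine ⟨y₀ + s • y, fun j => add_nonneg (hy₀ j) (smul_nonneg hs (hy j)), ?_⟩
      rw [mulVec_add, mulVec_add, mulVec_smul, mulVec_smul]
      calc Q.E *ᵥ x₀ + s • (Q.E *ᵥ x) + (Q.F *ᵥ y₀ + s • (Q.F *ᵥ y))
          = (Q.E *ᵥ x₀ + Q.F *ᵥ y₀) + s • (Q.E *ᵥ x + Q.F *ᵥ y) := by rw [smul_add]; abel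
        _ = Q.g := by rw [hx₀y₀, hxy, smul_zero, add_zero]
    obtain ⟨R, hR⟩ := (Metric.isBounded_iff_subset_closedBall (0 : ι → ℝ)).1 hbdd
    by_contra hneg
    have hx0 : x ≠ 0 := by
      rintro rfl
      simp at hneg
    have hnorm : 0 < ‖x‖ := norm_pos_iff.2 hx0
    set s : ℝ := (R + ‖x₀‖ + 1) / ‖x‖ with hs
    have hs0 : 0 ≤ s := by
      have : 0 ≤ R := by
        have h := hR (hray 0 le_rfl)
        rw [Metric.mem_closedBall, dist_zero_right] at h
        exact (norm_nonneg _).trans h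
      positivity
    have hmem := hR (hray s hs0)
    rw [Metric.mem_closedBall, dist_zero_right] at hmem
    have h1 : ‖s • x‖ ≤ ‖x₀ + s • x‖ + ‖x₀‖ := by
      have := norm_sub_le (x₀ + s • x) x₀
      rwa [add_sub_cancel_left] at this
    rw [norm_smul, Real.norm_of_nonneg hs0, hs, div_mul_cancel₀ _ hnorm.ne'] at h1
    linarith
  · -- `λ > 0`: `λ⁻¹ x ∈ K`
    have hmem : t⁻¹ • x ∈ Q.projSet := by
      refine ⟨t⁻¹ • y, fun j => smul_nonneg (inv_nonneg.2 ht) (hy j), ?_⟩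
      rw [mulVec_smul, mulVec_smul, ← smul_add, hxy, smul_smul, inv_mul_cancel₀ htpos.ne', one_smul]
    have := hc _ hmem
    rw [dotProduct_smul, smul_eq_mul] at this
    exact (mul_nonneg_iff_of_pos_left (inv_pos.2 htpos)).1 this

end Homogenize

/-! ### The UDISJ slack inside the correlation cone -/

section Cor

variable {m : ℕ}

/-- `𝟙_A ∈ ℝ^m`. [cite: BraunEtAl2012, §2.3 (2.7) (p. 8)] -/
def corConeIndVec (A : Finset (Fin m)) : Fin m → ℝ := fun i => if i ∈ A then 1 else 0

/-- `(−1, 𝟙_A) ∈ ℝ^{m+1}` (the vector of `T_a = (−1,a)(−1,a)ᵀ`). [cite: BraunEtAl2012, §2.3 (2.7) (p. 8)] -/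
def corConeTestVec (A : Finset (Fin m)) : Fin (m + 1) → ℝ := Fin.cons (-1) (corConeIndVec A)

/-- `(1, 𝟙_B) ∈ ℝ^{m+1}` (the vector of `U^b = (1,b)(1,b)ᵀ`). [cite: BraunEtAl2012, §2.3 (2.7) (p. 8)] -/
def corConePointVec (B : Finset (Fin m)) : Fin (m + 1) → ℝ := Fin.cons 1 (corConeIndVec B)

/-- `Σ_i 𝟙_A(i) 𝟙_B(i) = |A ∩ B|`. [cite: BraunEtAl2012, §2.3 (p. 8, "`aᵀb`")] -/
theorem sum_corConeIndVec_mul (A B : Finset (Fin m)) : ∑ i, corConeIndVec A i * corConeIndVec B i = ((A ∩ B).card : ℝ) := by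
  classical
  have h : ∀ i, corConeIndVec A i * corConeIndVec B i = if i ∈ A ∩ B then (1 : ℝ) else 0 := by
    intro i
    unfold corConeIndVec
    by_cases ha : i ∈ A <;> by_cases hb : i ∈ B <;> simp [ha, hb, Finset.mem_inter]
  simp_rw [h]
  rw [Finset.sum_boole, Finset.filter_mem_eq_inter, Finset.univ_inter]

/-- `(−1, 𝟙_A)·(1, 𝟙_B) = |A ∩ B| − 1`. [cite: BraunEtAl2012, §2.3 (p. 8, "`⟨T_a, U^b⟩ = (1 − aᵀb)²`")] -/
theorem corConeTestVec_dotProduct_pointVec (A B : Finset (Fin m)) :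
    corConeTestVec A ⬝ᵥ corConePointVec B = ((A ∩ B).card : ℝ) - 1 := by
  unfold corConeTestVec corConePointVec dotProduct
  rw [Fin.sum_univ_succ]
  simp only [Fin.cons_zero, Fin.cons_succ, mul_one]
  rw [sum_corConeIndVec_mul]
  ring

/-- `⟨w wᵀ, c cᵀ⟩ = (wᵀc)²`. [cite: BraunEtAl2012, §2.3 (p. 8, "`⟨T_a, U^b⟩ = (1 − aᵀb)²`")] -/
theorem flat_vecMulVec_dotProduct_vecOuter (w c : Fin (m + 1) → ℝ) :
    flat (vecMulVec w w) ⬝ᵥ vecOuter (m + 1) c = (w ⬝ᵥ c) ^ 2 := by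
  rw [flat_dotProduct_vecOuter, sq, dotProduct, Finset.sum_mul_sum]
  refine Finset.sum_congr rfl fun i _ => Finset.sum_congr rfl fun j _ => ?_
  rw [vecMulVec_apply]
  ring

/-- `⟨T_A, z⟩ ≥ 0` on `ρ·COR(m+1)` for `ρ ≥ 0` (`T_A` psd against the psd generators `ccᵀ`; «both matrices
are positive semidefinite», p. 8). [cite: BraunEtAl2012, §2.3 proof of Prop. 3 (p. 8)] -/
theorem flat_vecMulVec_nonneg_on_smul_corPolytope {ρ : ℝ} (hρ : 0 ≤ ρ) (w : Fin (m + 1) → ℝ)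
    {z : Fin ((m + 1) * (m + 1)) → ℝ} (hz : z ∈ ρ • corPolytope (m + 1)) :
    0 ≤ flat (vecMulVec w w) ⬝ᵥ z := by
  obtain ⟨c, hc, rfl⟩ := Set.mem_smul_set.1 hz
  rw [dotProduct_smul, smul_eq_mul]
  refine mul_nonneg hρ ?_
  have hlin : IsLinearMap ℝ (fun x : Fin ((m + 1) * (m + 1)) → ℝ => flat (vecMulVec w w) ⬝ᵥ x) :=
    ⟨fun x y => dotProduct_add _ x y, fun a x => by rw [dotProduct_smul]⟩
  have hconv : Convex ℝ {x : Fin ((m + 1) * (m + 1)) → ℝ | 0 ≤ flat (vecMulVec w w) ⬝ᵥ x} :=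
    convex_halfSpace_ge hlin 0
  refine (convexHull_min ?_ hconv) hc
  rintro _ ⟨a, rfl⟩
  show 0 ≤ flat (vecMulVec w w) ⬝ᵥ vecOuter (m + 1) (bvec a)
  rw [flat_vecMulVec_dotProduct_vecOuter]
  exact sq_nonneg _

/-- `(1, 𝟙_B)(1, 𝟙_B)ᵀ` is a vertex of `COR(m+1)`. [cite: BraunEtAl2012, §2.3 (p. 8, the correlation
matrices `(b₀, b)(b₀, b)ᵀ`)] -/
theorem vecOuter_corConePointVec_mem_corPolytope (B : Finset (Fin m)) :
    vecOuter (m + 1) (corConePointVec B) ∈ corPolytope (m + 1) := by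
  classical
  refine subset_convexHull ℝ _ ⟨Fin.cons true (fun i => decide (i ∈ B)), ?_⟩
  show vecOuter (m + 1) (bvec _) = vecOuter (m + 1) (corConePointVec B)
  congr 1
  funext j
  refine Fin.cases ?_ (fun i => ?_) j
  · simp [bvec, corConePointVec]
  · unfold bvec corConePointVec corConeIndVec
    rw [Fin.cons_succ, Fin.cons_succ]
    by_cases hi : i ∈ B <;> simp [hi]

/-- **Proposition 3 in correlation coordinates**: if `COR(m+1) ⊆ K ⊆ ρ·COR(m+1)` (`ρ ≥ 0`) and `K` has a
size-`r` extended formulation, then `(3/2)^m ≤ r + 2`. [cite: BraunEtAl2012, §2.3 Prop. 3 and its proof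
(p. 8, "`r + 1 ≥ xc(CUTCONE(n)) = xc(CORCONE(n−1)) = 2^{Ω(n)}`")] -/
theorem corPolytope_sandwich_xc_ge {m r : ℕ} {ρ : ℝ} (hρ : 0 ≤ ρ) {K : Set (Fin ((m + 1) * (m + 1)) → ℝ)}
    (hP : corPolytope (m + 1) ⊆ K) (hQ : K ⊆ ρ • corPolytope (m + 1)) (hEF : HasEFOfSize K r) :
    (3 / 2 : ℝ) ^ m ≤ r + 2 := by
  classical
  obtain ⟨Q, hQK⟩ := hEF
  subst hQK
  have hEF' : HasEFOfSize Q.homogenize.projSet (r + 1) := ⟨Q.homogenize, rfl⟩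
  have hbdd : Bornology.IsBounded Q.projSet := ((isBounded_corPolytope (m + 1)).smul₀ ρ).subset hQ
  have hne : Q.projSet.Nonempty := ⟨_, hP (vecOuter_corConePointVec_mem_corPolytope ∅)⟩
  have hvalid : ∀ A : Finset (Fin m), ∀ x ∈ Q.homogenize.projSet,
      (-flat (vecMulVec (corConeTestVec A) (corConeTestVec A))) ⬝ᵥ x ≤ 0 := by
    intro A x hx
    rw [neg_dotProduct, neg_nonpos]
    exact Q.nonneg_on_homogenize hbdd hne
      (fun z hz => flat_vecMulVec_nonneg_on_smul_corPolytope hρ (corConeTestVec A) (hQ hz)) x hx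
  have hpts : ∀ B : Finset (Fin m), vecOuter (m + 1) (corConePointVec B) ∈ Q.homogenize.projSet :=
    fun B => Q.mem_homogenize_of_mem (hP (vecOuter_corConePointVec_mem_corPolytope B))
  obtain ⟨U, T, hU, hT, hfac⟩ := hEF'.exists_nonneg_factorization (fun B => vecOuter (m + 1) (corConePointVec B))
    hpts (fun A => -flat (vecMulVec (corConeTestVec A) (corConeTestVec A))) (fun _ => 0) hvalid
  have hslack : ∀ A B : Finset (Fin m), ∑ i, U A i * T B i = (((A ∩ B).card : ℝ) - 1) ^ 2 := by
    intro A B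
    rw [← hfac, neg_dotProduct, sub_neg_eq_add, zero_add, flat_vecMulVec_dotProduct_vecOuter,
      corConeTestVec_dotProduct_pointVec]
  -- Kaibel–Weltge: the support rectangles of the slots avoid `|A ∩ B| = 1` and cover the disjoint pairs
  have key := three_pow_le_card_mul_two_pow_of_cover_univ (α := Fin m)
    (Finset.univ : Finset (Option (Fin (r + 1)))) (fun i => {A | 0 < U A i}) (fun i => {B | 0 < T B i})
    (fun i _ A hA B hB hone => by
      simp only [Set.mem_setOf_eq] at hA hB
      have h0 : ∑ j, U A j * T B j = 0 := by rw [hslack, hone]; norm_num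
      have hle : U A i * T B i ≤ ∑ j, U A j * T B j :=
        Finset.single_le_sum (f := fun j => U A j * T B j) (fun j _ => mul_nonneg (hU A j) (hT B j))
          (Finset.mem_univ i)
      have hpos : 0 < U A i * T B i := mul_pos hA hB
      linarith)
    (fun A B hAB => by
      have h1 : ∑ j, U A j * T B j = 1 := by
        rw [hslack, Finset.disjoint_iff_inter_eq_empty.1 hAB, Finset.card_empty]; norm_num
      by_contra hnone
      have hzero : ∑ j, U A j * T B j = 0 := by
        refine Finset.sum_eq_zero fun j _ => ?_
        by_contra hj
        have hUj : 0 < U A j := lt_of_le_of_ne (hU A j) (fun h => hj (by rw [← h, zero_mul]))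
        have hTj : 0 < T B j := lt_of_le_of_ne (hT B j) (fun h => hj (by rw [← h, mul_zero]))
        exact hnone ⟨j, Finset.mem_univ _, hUj, hTj⟩
      linarith)
  simp only [Finset.card_univ, Fintype.card_option, Fintype.card_fin] at key
  have key' : (3 : ℝ) ^ m ≤ ((r + 1 + 1 : ℕ) : ℝ) * 2 ^ m := by exact_mod_cast key
  have key'' : (3 : ℝ) ^ m ≤ ((r : ℝ) + 2) * 2 ^ m := by
    have e : ((r + 1 + 1 : ℕ) : ℝ) = (r : ℝ) + 2 := by push_cast; ring
    rw [e] at key'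
    exact key'
  rw [div_pow, div_le_iff₀ (by positivity)]
  exact key''

end Cor

/-! ### Proposition 3 as printed: the cut polytope of the complete graph -/

/-- ★ **BFPS 2012, Proposition 3** («For every `ρ ≥ 1`, every `ρ`-approximate EF of the Max CUT problem
with arbitrary weights has size `2^{Ω(n)}` … `xc(CUT(n), ρ CUT(n)) = 2^{Ω(n)}`»): for `CUT(n+2) =
CUT□(K_{n+2})`, every `K` with `CUT(n+2) ⊆ K ⊆ ρ·CUT(n+2)` admitting a size-`r` extended formulation has
`(3/2)^n ≤ r + 2`.  Via the covariance map to `COR(n+1)` and `corPolytope_sandwich_xc_ge`.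
[cite: BraunEtAl2012, Prop. 3 (§2.3, p. 8)] -/
theorem BFPS2012_prop3 (n : ℕ) {ρ : ℝ} (hρ : 1 ≤ ρ)
    {K : Set ((⊤ : SimpleGraph (Fin (n + 2))).edgeSet → ℝ)} {r : ℕ}
    (hP : cutPolytope (⊤ : SimpleGraph (Fin (n + 2))) ⊆ K)
    (hQ : K ⊆ ρ • cutPolytope (⊤ : SimpleGraph (Fin (n + 2)))) (hEF : HasEFOfSize K r) :
    (3 / 2 : ℝ) ^ n ≤ r + 2 := by
  have himg := hEF.image_linearMap (DeSimoneXC.covMap (n + 1))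
  refine corPolytope_sandwich_xc_ge (m := n) (zero_le_one.trans hρ) ?_ ?_ himg
  · rw [← DeSimoneXC.covMap_image (n + 1)]
    exact Set.image_mono hP
  · rintro _ ⟨x, hx, rfl⟩
    obtain ⟨c, hc, rfl⟩ := Set.mem_smul_set.1 (hQ hx)
    refine Set.mem_smul_set.2 ⟨DeSimoneXC.covMap (n + 1) c, ?_, by rw [map_smul]⟩
    rw [← DeSimoneXC.covMap_image (n + 1)]
    exact Set.mem_image_of_mem _ hc

end Literature.Barriers.PneNP

end
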